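import Literature.Geometry.Riemannian.MetricFlowFConvergenceMeasures
import Literature.Geometry.Riemannian.WassersteinW1Complete
import Literature.Geometry.Riemannian.WassersteinW1LimitPoints
import HarnessLib

/-!
# The limit of a fast `𝔽`-Cauchy chain within a correspondence, I: good times and limit measures
# (Bamler 2023, §5.4, Lemma 5.20)

R. Bamler, *Compactness theory of the space of super Ricci flows*, Invent. Math. 233 (2023), §5.4,
Lemma 5.20 (arXiv v1 Lemma 121): *"Let `(𝒳ⁱ, (μⁱ_t)_{t ∈ I'^{,i}})`, `i ∈ ℕ`, be a sequence of
metric flow pairs over `I` that are fully defined over `J`. Consider a correspondence `ℭ` between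
the metric flows `𝒳ⁱ` over `I` that is also fully defined over `J` and suppose that the metric
spaces `(Z_t, d^Z_t)_{t ∈ I}` are complete. Suppose that the metric flow pairs form a Cauchy
sequence within `ℭ` that is uniform over `J` … Then there is a metric flow pair
`(𝒳^∞, (μ^∞_t)_{t ∈ I'^{,∞}})` over `I` … such that we have convergence … within `ℭ'`."* Its proof
constructs the limit along a FAST chain: *"we may further assume that
`d^{ℭ,J}_𝔽((𝒳ⁱ, (μⁱ_t)), (𝒳^{i+1}, (μ^{i+1}_t))) ≤ 2^{-i-2}`. For each `i` choose `E^{i,i+1} ⊂ I` …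
Set `Eⁱ := E^{i,i+1} ∪ E^{i+1,i+2} ∪ …`. Then `|Eⁱ| ≤ 4^{-i}`, `E¹ ⊃ E² ⊃ …`. So `E^∞ := ⋂ Eⁱ` is a
set of measure zero. For any `t ∈ I ∖ E^∞`, the probability measures `(φⁱ_t)_* μⁱ_t ∈ 𝒫(Z_t)` are
defined for large `i` and form a Cauchy sequence in `(𝒫(Z_t), d^{Z_t}_{W₁})`. So they converge to
a probability measure `μ^∞_t ∈ 𝒫(Z_t)` and `d^{Z_t}_{W₁}((φⁱ_t)_* μⁱ_t, μ^∞_t) ≤ 2^{-i}`."*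

This file is the first part of the ASSEMBLY of this construction in the tree's vocabulary (from
`FDistAdmissibleWith.wassersteinW1_map_le`, the completeness of `(𝒫(Z_t), d_{W₁})` and the lower
semicontinuity of `d_{W₁}`). The data of a fast chain — `H`-concentrated metric flow pairs `P n`
over `I₀`, one correspondence `ℭ` of the family of their flows with complete separable comparison
spaces, exceptional sets `E n` witnessing the admissibility of the radius `2^{-n}` for
`d^{ℭ,J}_𝔽(P n, P (n+1))` (`FDistAdmissibleWith`), and the inclusions
`I₀ ∖ E n ⊆ I''^{,n} ∩ I''^{,n+1}` — are bundled in the structure `MetricFlowPair.ChainSetup`: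

* `ChainSetup.Ebad i = ⋃ₖ E (i + k)` (the source's `Eⁱ`), the good times `G i := I₀ ∖ Ebad i`,
  `N := ⋂ᵢ Ebad i` (`E^∞`, a measurable null set, `volume_N`) and `I' := I₀ ∖ N` (`I'^{,∞}`);
* `ChainSetup.push n t h = (φⁿ_t)_* μⁿ_t ∈ 𝒫(Z_t)` and the chain estimate
  `d_{W₁}((φⁿ_t)_* μⁿ_t, (φ^{n+j}_t)_* μ^{n+j}_t) ≤ 2 · 2^{-n}` at good times `t ∈ G n`
  (`wassersteinW1_push_push_le`);
* the limit measure `ChainSetup.m t ht = μ^∞_t ∈ 𝒫(Z_t)` for `t ∈ I'`, with the rate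
  `d_{W₁}((φⁿ_t)_* μⁿ_t, μ^∞_t) ≤ 2 · 2^{-n}` for `t ∈ G n` (`wassersteinW1_push_m_le`,
  `tendsto_push_m`), the approximation of the points of `supp μ^∞_t` by images of points
  (`exists_seq_tendsto`) and the mass bound `liminf μ^{i+k}_t(B(x_k, r)) > 0`
  (`liminf_measure_ball_pos`).

## References

* R. H. Bamler, *Compactness theory of the space of super Ricci flows*, Invent. Math. 233 (2023),
  1121–1277 (arXiv:2008.09298), §5.4, Lemma 5.20 (arXiv v1 Lemma 121) and its proof; §5.1,
  Def. 5.6, Rem. 5.7. [Bamler2023]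
-/

noncomputable section

open Set MeasureTheory Filter TopologicalSpace Function
open scoped Topology ENNReal NNReal

namespace Literature.Geometry.Riemannian

universe u

namespace MetricFlowPair

open MetricFlow

/-- **The data of a fast `𝔽`-Cauchy chain within a correspondence** (Bamler 2023, §5.4, proof of
Lemma 5.20, after the two reductions): `H`-concentrated metric flow pairs `P n` over `I₀`, a
correspondence `ℭ` between all the flows `(P n).flow` over `I₀` with complete separable comparison
spaces `Z_t`, and exceptional sets `E n = E^{n,n+1}` with which the radius `2^{-n}` is admissible
for `d^{ℭ,J}_𝔽(P n, P (n+1))`, together with `I₀ ∖ E n ⊆ I''^{,n} ∩ I''^{,n+1}`.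
[cite: Bamler2023, §5.4, Lemma 5.20 (arXiv v1 Lemma 121), proof] -/
structure ChainSetup (I₀ : Set ℝ) : Type (u + 1) where
  /-- The concentration constant `H`. -/
  H : ℝ
  /-- `0 ≤ H`. -/
  hH : 0 ≤ H
  /-- The metric flow pairs `(𝒳ⁿ, (μⁿ_t))`. -/
  P : ℕ → MetricFlowPair.{u} I₀
  /-- Each `𝒳ⁿ` is `H`-concentrated. -/
  hP : ∀ n, (P n).flow.IsHConcentrated H
  /-- The correspondence `ℭ` between all the flows, over `I₀`. -/
  ℭ : FamilyCorrespondence (fun n ↦ (P n).flow) I₀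
  /-- The comparison spaces are complete … -/
  hZc : ∀ t, CompleteSpace (ℭ.Z t)
  /-- … and separable. -/
  hZs : ∀ t, SeparableSpace (ℭ.Z t)
  /-- The set of times `J`. -/
  J : Set ℝ
  /-- The exceptional sets `E^{n,n+1}`. -/
  E : ℕ → Set ℝ
  /-- `2^{-n}` is admissible for `d^{ℭ,J}_𝔽(P n, P (n+1))` with exceptional set `E n`. -/
  hE : ∀ n, FDistAdmissibleWith (P n) (P (n + 1)) (ℭ.pair n (n + 1)) (E n) J (2⁻¹ ^ n)
  /-- `I₀ ∖ E n ⊆ I''^{,n}`. -/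
  hdom₁ : ∀ n, I₀ \ E n ⊆ ℭ.dom n
  /-- `I₀ ∖ E n ⊆ I''^{,n+1}`. -/
  hdom₂ : ∀ n, I₀ \ E n ⊆ ℭ.dom (n + 1)

namespace ChainSetup

variable {I₀ : Set ℝ} (S : ChainSetup.{u} I₀)

/-- The comparison spaces of the chain are complete.
[cite: Bamler2023, §5.4, Lemma 5.20 (arXiv v1 Lemma 121)] -/
instance instCompleteSpaceZ (t : I₀) : CompleteSpace (S.ℭ.Z t) := S.hZc t

/-- The comparison spaces of the chain are separable.
[cite: Bamler2023, §5.4, Lemma 5.20 (arXiv v1 Lemma 121)] -/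
instance instSeparableSpaceZ (t : I₀) : SeparableSpace (S.ℭ.Z t) := S.hZs t

/-! ### Good times -/

/-- `Eⁱ := E^{i,i+1} ∪ E^{i+1,i+2} ∪ …`, the bad times from stage `i` on.
[cite: Bamler2023, §5.4, Lemma 5.20 (arXiv v1 Lemma 121), proof] -/
def Ebad (i : ℕ) : Set ℝ := ⋃ k, S.E (i + k)

/-- The good times at stage `i`: `I₀ ∖ Eⁱ`.
[cite: Bamler2023, §5.4, Lemma 5.20 (arXiv v1 Lemma 121), proof] -/
def G (i : ℕ) : Set ℝ := I₀ \ S.Ebad i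

/-- `E^∞ := ⋂ᵢ Eⁱ`, the exceptional set of the limit.
[cite: Bamler2023, §5.4, Lemma 5.20 (arXiv v1 Lemma 121), proof] -/
def N : Set ℝ := ⋂ i, S.Ebad i

/-- `I'^{,∞} := I₀ ∖ E^∞`, the times over which the limit is defined.
[cite: Bamler2023, §5.4, Lemma 5.20 (arXiv v1 Lemma 121), proof] -/
def I' : Set ℝ := I₀ \ S.N

/-- `E n ⊆ I₀`. [cite: Bamler2023, §5.1, Def. 5.6] -/
theorem E_subset (n : ℕ) : S.E n ⊆ I₀ := (S.hE n).subset

/-- `E n` is measurable. [cite: Bamler2023, §5.1, Def. 5.6] -/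
theorem measurableSet_E (n : ℕ) : MeasurableSet (S.E n) := (S.hE n).measurableSet

/-- `|E n| ≤ 4^{-n}`, in the form `volume (E n) ≤ (1/4)^n`.
[cite: Bamler2023, §5.4, Lemma 5.20 (arXiv v1 Lemma 121), proof] -/
theorem volume_E_le (n : ℕ) : volume (S.E n) ≤ (4⁻¹ : ℝ≥0∞) ^ n := by
  refine (S.hE n).volume_le.trans_eq ?_
  have h : ((2⁻¹ : ℝ) ^ n) ^ 2 = (4⁻¹ : ℝ) ^ n := by
    rw [← pow_mul, mul_comm, pow_mul]
    norm_num
  rw [h, ENNReal.ofReal_pow (by norm_num), ENNReal.ofReal_inv_of_pos (by norm_num),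
    ENNReal.ofReal_ofNat]

/-- `E^{i+k} ⊆ Eⁱ`. [cite: Bamler2023, §5.4, Lemma 5.20 (arXiv v1 Lemma 121), proof] -/
theorem Ebad_add_subset (i k : ℕ) : S.Ebad (i + k) ⊆ S.Ebad i := by
  intro t ht
  obtain ⟨l, hl⟩ := mem_iUnion.1 ht
  exact mem_iUnion.2 ⟨k + l, by rwa [← add_assoc]⟩

/-- The good times increase with the stage: `G i ⊆ G j` for `i ≤ j`.
[cite: Bamler2023, §5.4, Lemma 5.20 (arXiv v1 Lemma 121), proof] -/
theorem G_mono {i j : ℕ} (hij : i ≤ j) : S.G i ⊆ S.G j := by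
  intro t ht
  refine ⟨ht.1, fun h ↦ ht.2 ?_⟩
  have h' := S.Ebad_add_subset i (j - i)
  rw [Nat.add_sub_cancel' hij] at h'
  exact h' h

/-- Good times are times of the limit: `G i ⊆ I'^{,∞}`.
[cite: Bamler2023, §5.4, Lemma 5.20 (arXiv v1 Lemma 121), proof] -/
theorem G_subset_I' (i : ℕ) : S.G i ⊆ S.I' :=
  fun _ ht ↦ ⟨ht.1, fun h ↦ ht.2 (mem_iInter.1 h i)⟩

/-- Every time of the limit is a good time at some stage.
[cite: Bamler2023, §5.4, Lemma 5.20 (arXiv v1 Lemma 121), proof] -/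
theorem exists_mem_G {t : ℝ} (ht : t ∈ S.I') : ∃ i, t ∈ S.G i := by
  by_contra h
  exact ht.2 (mem_iInter.2 fun i ↦ by_contra fun hi ↦ h ⟨i, ht.1, hi⟩)

/-- Two times of the limit are good at a common stage.
[cite: Bamler2023, §5.4, Lemma 5.20 (arXiv v1 Lemma 121), proof] -/
theorem exists_mem_G₂ {s t : ℝ} (hs : s ∈ S.I') (ht : t ∈ S.I') : ∃ i, s ∈ S.G i ∧ t ∈ S.G i := by
  obtain ⟨a, ha⟩ := S.exists_mem_G hs
  obtain ⟨b, hb⟩ := S.exists_mem_G ht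
  exact ⟨a + b, S.G_mono (Nat.le_add_right a b) ha, S.G_mono (Nat.le_add_left b a) hb⟩

/-- A good time at stage `i` lies in the domain `I''^{,i+k}` of every later flow (the term used in
the statement of Lemma 5.20 in the tree).
[cite: Bamler2023, §5.4, Lemma 5.20 (arXiv v1 Lemma 121), proof] -/
theorem memDom {i : ℕ} {t : ℝ} (ht : t ∈ S.G i) (k : ℕ) : t ∈ S.ℭ.dom (i + k) :=
  S.hdom₁ (i + k) ⟨ht.1, fun h ↦ ht.2 (mem_iUnion.2 ⟨k, h⟩)⟩

/-- A good time at stage `n` lies in `I''^{,n}`.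
[cite: Bamler2023, §5.4, Lemma 5.20 (arXiv v1 Lemma 121), proof] -/
theorem memDom₀ {n : ℕ} {t : ℝ} (ht : t ∈ S.G n) : t ∈ S.ℭ.dom n := S.memDom ht 0

/-- `G i ⊆ I₀ ∖ E n` for `i ≤ n`. [cite: Bamler2023, §5.4, Lemma 5.20 (arXiv v1 Lemma 121), proof]
-/
theorem G_subset_diff {i n : ℕ} (hin : i ≤ n) : S.G i ⊆ I₀ \ S.E n := fun t ht ↦ by
  refine ⟨ht.1, fun h ↦ ht.2 (mem_iUnion.2 ⟨n - i, ?_⟩)⟩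
  rwa [Nat.add_sub_cancel' hin]

/-- `E^∞` is measurable. [cite: Bamler2023, §5.4, Lemma 5.20 (arXiv v1 Lemma 121), proof] -/
theorem measurableSet_N : MeasurableSet S.N :=
  MeasurableSet.iInter fun _ ↦ MeasurableSet.iUnion fun _ ↦ S.measurableSet_E _

/-- `|Eⁱ| ≤ ∑ₖ 4^{-(i+k)} = (4/3) 4^{-i}`.
[cite: Bamler2023, §5.4, Lemma 5.20 (arXiv v1 Lemma 121), proof] -/
theorem volume_Ebad_le (i : ℕ) : volume (S.Ebad i) ≤ (4⁻¹ : ℝ≥0∞) ^ i * (1 - 4⁻¹)⁻¹ := by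
  calc volume (S.Ebad i) ≤ ∑' k, volume (S.E (i + k)) := measure_iUnion_le _
    _ ≤ ∑' k, (4⁻¹ : ℝ≥0∞) ^ i * (4⁻¹ : ℝ≥0∞) ^ k :=
        ENNReal.tsum_le_tsum fun k ↦ (S.volume_E_le (i + k)).trans_eq (pow_add _ _ _)
    _ = (4⁻¹ : ℝ≥0∞) ^ i * (1 - 4⁻¹)⁻¹ := by rw [ENNReal.tsum_mul_left, ENNReal.tsum_geometric]

/-- **`E^∞` is a null set** (`|Eⁱ| ≤ 4^{-i} → 0`).
[cite: Bamler2023, §5.4, Lemma 5.20 (arXiv v1 Lemma 121), proof] -/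
theorem volume_N : volume S.N = 0 := by
  have h : Tendsto (fun i : ℕ ↦ (4⁻¹ : ℝ≥0∞) ^ i * (1 - 4⁻¹)⁻¹) atTop (𝓝 0) := by
    have h := ENNReal.Tendsto.mul_const (b := (1 - 4⁻¹)⁻¹)
      (ENNReal.tendsto_pow_atTop_nhds_zero_of_lt_one (by norm_num : (4⁻¹ : ℝ≥0∞) < 1))
      (Or.inr (ENNReal.inv_ne_top.2 (tsub_pos_of_lt (by norm_num : (4⁻¹ : ℝ≥0∞) < 1)).ne'))
    rwa [zero_mul] at h
  refine le_antisymm (ge_of_tendsto' h fun i ↦ ?_) zero_le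
  exact (measure_mono (iInter_subset _ i)).trans (S.volume_Ebad_le i)

/-- `E^∞ ⊆ I₀`. [cite: Bamler2023, §5.4, Lemma 5.20 (arXiv v1 Lemma 121), proof] -/
theorem N_subset : S.N ⊆ I₀ := fun _ ht ↦ by
  obtain ⟨k, hk⟩ := mem_iUnion.1 (mem_iInter.1 ht 0)
  exact S.E_subset _ hk

/-- `I₀ ∖ I'^{,∞} = E^∞`. [cite: Bamler2023, §5.4, Lemma 5.20 (arXiv v1 Lemma 121), proof] -/
theorem diff_I' : I₀ \ S.I' = S.N := by
  ext t
  refine ⟨fun ht ↦ by_contra fun h ↦ ht.2 ⟨ht.1, h⟩, fun ht ↦ ⟨S.N_subset ht, fun h ↦ h.2 ht⟩⟩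

/-- `I'^{,∞} ⊆ I₀`. [cite: Bamler2023, §5.4, Lemma 5.20 (arXiv v1 Lemma 121), proof] -/
theorem I'_subset : S.I' ⊆ I₀ := fun _ ht ↦ ht.1

/-! ### The pushed-forward measures `(φⁿ_t)_* μⁿ_t` -/

/-- `(φⁿ_t)_* μⁿ_t ∈ 𝒫(Z_t)` for `t ∈ I''^{,n}`.
[cite: Bamler2023, §5.4, Lemma 5.20 (arXiv v1 Lemma 121), proof] -/
def push (n : ℕ) (t : ℝ) (h : t ∈ S.ℭ.dom n) : Measure (S.ℭ.Z ⟨t, (S.ℭ.dom_subset n h).2⟩) :=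
  ((S.P n).μ ⟨t, (S.ℭ.dom_subset n h).1⟩).map (S.ℭ.φ n t h)

/-- `(φⁿ_t)_* μⁿ_t` is a probability measure.
[cite: Bamler2023, §5.4, Lemma 5.20 (arXiv v1 Lemma 121), proof] -/
instance isProbabilityMeasure_push (n : ℕ) (t : ℝ) (h : t ∈ S.ℭ.dom n) :
    IsProbabilityMeasure (S.push n t h) := by
  haveI := (S.P n).isProbabilityMeasure_μ ⟨t, (S.ℭ.dom_subset n h).1⟩
  exact Measure.isProbabilityMeasure_map (S.ℭ.isometry n t h).continuous.measurable.aemeasurable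

/-- The pushed measure does not depend on the way the index is written. [folklore] -/
theorem push_congr {n n' : ℕ} (e : n = n') (t : ℝ) (h : t ∈ S.ℭ.dom n) (h' : t ∈ S.ℭ.dom n') :
    S.push n t h = S.push n' t h' := by
  subst e
  rfl

/-- **Remark 5.7 along the chain**: `d_{W₁}((φⁿ_t)_* μⁿ_t, (φ^{n+1}_t)_* μ^{n+1}_t) ≤ 2^{-n}` for
`t ∈ I₀ ∖ E n` (`FDistAdmissibleWith.wassersteinW1_map_le`).
[cite: Bamler2023, §5.1, Rem. 5.7; §5.4, Lemma 5.20, proof] -/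
theorem wassersteinW1_push_succ_le {n : ℕ} {t : ℝ} (ht : t ∈ I₀ \ S.E n) (h : t ∈ S.ℭ.dom n)
    (h' : t ∈ S.ℭ.dom (n + 1)) :
    wassersteinW1 (S.push n t h) (S.push (n + 1) t h') ≤ ENNReal.ofReal (2⁻¹ ^ n) :=
  (S.hE n).wassersteinW1_map_le ht h h'

/-- **The chain estimate**: for a good time `t ∈ G n`,
`d_{W₁}((φⁿ_t)_* μⁿ_t, (φ^{n+j}_t)_* μ^{n+j}_t) ≤ ∑_{l<j} 2^{-(n+l)} ≤ 2 · 2^{-n}` (triangle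
inequality in `𝒫(Z_t)`). [cite: Bamler2023, §5.4, Lemma 5.20 (arXiv v1 Lemma 121), proof] -/
theorem wassersteinW1_push_push_le {n : ℕ} {t : ℝ} (ht : t ∈ S.G n) (j : ℕ) :
    wassersteinW1 (S.push n t (S.memDom₀ ht)) (S.push (n + j) t (S.memDom ht j)) ≤
      ENNReal.ofReal (2 * 2⁻¹ ^ n - 2 * 2⁻¹ ^ (n + j)) := by
  induction j with
  | zero =>
      show wassersteinW1 (S.push n t (S.memDom₀ ht)) (S.push n t (S.memDom₀ ht)) ≤
        ENNReal.ofReal (2 * 2⁻¹ ^ n - 2 * 2⁻¹ ^ n)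
      rw [sub_self, ENNReal.ofReal_zero]
      exact (wassersteinW1_self _).le
  | succ j ih =>
      have hj : t ∈ I₀ \ S.E (n + j) := S.G_subset_diff (Nat.le_add_right n j) ht
      calc wassersteinW1 (S.push n t (S.memDom₀ ht)) (S.push (n + (j + 1)) t (S.memDom ht (j + 1)))
          ≤ wassersteinW1 (S.push n t (S.memDom₀ ht)) (S.push (n + j) t (S.memDom ht j)) +
              wassersteinW1 (S.push (n + j) t (S.memDom ht j))
                (S.push (n + j + 1) t (S.memDom ht (j + 1))) := wassersteinW1_triangle _ _ _
        _ ≤ ENNReal.ofReal (2 * 2⁻¹ ^ n - 2 * 2⁻¹ ^ (n + j)) + ENNReal.ofReal (2⁻¹ ^ (n + j)) :=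
            add_le_add ih (S.wassersteinW1_push_succ_le hj _ _)
        _ = ENNReal.ofReal (2 * 2⁻¹ ^ n - 2 * 2⁻¹ ^ (n + (j + 1))) := by
            have h1 : (2⁻¹ : ℝ) ^ (n + j) ≤ 2⁻¹ ^ n :=
              pow_le_pow_of_le_one (by norm_num) (by norm_num) (Nat.le_add_right n j)
            rw [← ENNReal.ofReal_add (by linarith [h1]) (by positivity),
              show n + (j + 1) = (n + j) + 1 from rfl, pow_succ]
            ring_nf

/-- The chain estimate, coarse form: `d_{W₁}((φⁿ_t)_* μⁿ_t, (φ^{n'}_t)_* μ^{n'}_t) ≤ 2 · 2^{-n}` for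
`n ≤ n'` and `t ∈ G n`. [cite: Bamler2023, §5.4, Lemma 5.20 (arXiv v1 Lemma 121), proof] -/
theorem wassersteinW1_push_le_of_le {n n' : ℕ} (hnn' : n ≤ n') {t : ℝ} (ht : t ∈ S.G n)
    (h : t ∈ S.ℭ.dom n) (h' : t ∈ S.ℭ.dom n') :
    wassersteinW1 (S.push n t h) (S.push n' t h') ≤ ENNReal.ofReal (2 * 2⁻¹ ^ n) := by
  rw [S.push_congr (Nat.add_sub_cancel' hnn').symm t h' (S.memDom ht (n' - n))]
  exact (S.wassersteinW1_push_push_le ht (n' - n)).trans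
    (ENNReal.ofReal_le_ofReal
      (by linarith [pow_nonneg (by norm_num : (0 : ℝ) ≤ 2⁻¹) (n + (n' - n))]))

/-! ### The limit measures `μ^∞_t` -/

/-- **The limit measure exists**: for `t ∈ I'^{,∞}` there is `μ^∞_t ∈ 𝒫(Z_t)` with
`d_{W₁}((φⁿ_t)_* μⁿ_t, μ^∞_t) ≤ 2 · 2^{-n}` whenever `t ∈ G n` (the `W₁`-Cauchy sequence
`(φⁿ_t)_* μⁿ_t` converges by completeness of `(𝒫(Z_t), d_{W₁})`; the rate by lower semicontinuity
of `d_{W₁}`). [cite: Bamler2023, §5.4, Lemma 5.20 (arXiv v1 Lemma 121), proof] -/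
theorem exists_limitMeasure {t : ℝ} (ht : t ∈ S.I') :
    ∃ m : Measure (S.ℭ.Z ⟨t, ht.1⟩), IsProbabilityMeasure m ∧
      ∀ n (hn : t ∈ S.G n), wassersteinW1 (S.push n t (S.memDom₀ hn)) m ≤
        ENNReal.ofReal (2 * 2⁻¹ ^ n) := by
  obtain ⟨n₀, hn₀⟩ := S.exists_mem_G ht
  set μs : ℕ → Measure (S.ℭ.Z ⟨t, ht.1⟩) := fun k ↦ S.push (n₀ + k) t (S.memDom hn₀ k) with hμs
  have hrate : Tendsto (fun k : ℕ ↦ ENNReal.ofReal (2 * 2⁻¹ ^ (n₀ + k))) atTop (𝓝 0) := by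
    rw [← ENNReal.ofReal_zero]
    refine ENNReal.tendsto_ofReal ?_
    have h := (tendsto_pow_atTop_nhds_zero_of_lt_one (by norm_num : (0 : ℝ) ≤ 2⁻¹)
      (by norm_num : (2⁻¹ : ℝ) < 1)).comp (tendsto_add_atTop_nat n₀ |>.congr fun k ↦ add_comm k n₀)
    simpa using h.const_mul 2
  have hC : ∀ η : ℝ≥0∞, 0 < η → ∃ N, ∀ k ≥ N, ∀ l ≥ N, wassersteinW1 (μs k) (μs l) < η := by
    intro η hη
    obtain ⟨N, hN⟩ := eventually_atTop.1 ((tendsto_order.1 hrate).2 η hη)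
    refine ⟨N, fun k hk l hl ↦ ?_⟩
    rcases le_total k l with hkl | hlk
    · exact (S.wassersteinW1_push_le_of_le (Nat.add_le_add_left hkl n₀)
        (S.G_mono (Nat.le_add_right n₀ k) hn₀) _ _).trans_lt (hN k hk)
    · rw [wassersteinW1_comm]
      exact (S.wassersteinW1_push_le_of_le (Nat.add_le_add_left hlk n₀)
        (S.G_mono (Nat.le_add_right n₀ l) hn₀) _ _).trans_lt (hN l hl)
  obtain ⟨m, hm, hlim⟩ := exists_tendsto_wassersteinW1_nhds_zero_of_cauchySeq hC
  refine ⟨m, hm, fun n hn ↦ ?_⟩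
  -- lower semicontinuity of `d_{W₁}` along `μs k → m`
  have hlsc := wassersteinW1_le_liminf (X := S.ℭ.Z ⟨t, ht.1⟩)
    (μs := fun _ ↦ ⟨S.push n t (S.memDom₀ hn), inferInstance⟩)
    (μ := ⟨S.push n t (S.memDom₀ hn), inferInstance⟩) tendsto_const_nhds
    (tendsto_probabilityMeasure_mk_of_tendsto_wassersteinW1 hlim)
  refine hlsc.trans (liminf_le_of_frequently_le' (Eventually.frequently ?_))
  filter_upwards [eventually_ge_atTop n] with k hk
  exact S.wassersteinW1_push_le_of_le (hk.trans (Nat.le_add_left k n₀)) hn _ _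

/-- **The limit measure `μ^∞_t ∈ 𝒫(Z_t)`**, `t ∈ I'^{,∞}` (a choice of the `W₁`-limit of
`(φⁿ_t)_* μⁿ_t`). [cite: Bamler2023, §5.4, Lemma 5.20 (arXiv v1 Lemma 121), proof] -/
def m (t : ℝ) (ht : t ∈ S.I') : Measure (S.ℭ.Z ⟨t, ht.1⟩) :=
  (S.exists_limitMeasure ht).choose

/-- `μ^∞_t` is a probability measure.
[cite: Bamler2023, §5.4, Lemma 5.20 (arXiv v1 Lemma 121), proof] -/
instance isProbabilityMeasure_m (t : ℝ) (ht : t ∈ S.I') : IsProbabilityMeasure (S.m t ht) :=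
  (S.exists_limitMeasure ht).choose_spec.1

/-- **`d_{W₁}((φⁿ_t)_* μⁿ_t, μ^∞_t) ≤ 2 · 2^{-n}` for `t ∈ G n`.**
[cite: Bamler2023, §5.4, Lemma 5.20 (arXiv v1 Lemma 121), proof] -/
theorem wassersteinW1_push_m_le {t : ℝ} (ht : t ∈ S.I') {n : ℕ} (hn : t ∈ S.G n)
    (h : t ∈ S.ℭ.dom n) :
    wassersteinW1 (S.push n t h) (S.m t ht) ≤ ENNReal.ofReal (2 * 2⁻¹ ^ n) :=
  (S.exists_limitMeasure ht).choose_spec.2 n hn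

/-- `(φ^{i+k}_t)_* μ^{i+k}_t → μ^∞_t` in `d_{W₁}` for `t ∈ G i`.
[cite: Bamler2023, §5.4, Lemma 5.20 (arXiv v1 Lemma 121), proof] -/
theorem tendsto_push_m {t : ℝ} (ht : t ∈ S.I') {i : ℕ} (hi : t ∈ S.G i) :
    Tendsto (fun k ↦ wassersteinW1 (S.push (i + k) t (S.memDom hi k)) (S.m t ht)) atTop (𝓝 0) := by
  have hrate : Tendsto (fun k : ℕ ↦ ENNReal.ofReal (2 * 2⁻¹ ^ (i + k))) atTop (𝓝 0) := by
    rw [← ENNReal.ofReal_zero]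
    refine ENNReal.tendsto_ofReal ?_
    have h := (tendsto_pow_atTop_nhds_zero_of_lt_one (by norm_num : (0 : ℝ) ≤ 2⁻¹)
      (by norm_num : (2⁻¹ : ℝ) < 1)).comp (tendsto_add_atTop_nat i |>.congr fun k ↦ add_comm k i)
    simpa using h.const_mul 2
  exact tendsto_of_tendsto_of_tendsto_of_le_of_le tendsto_const_nhds hrate (fun _ ↦ zero_le)
    fun k ↦ S.wassersteinW1_push_m_le ht (S.G_mono (Nat.le_add_right i k) hi) _

/-- **Points of `X^∞_t = supp μ^∞_t` are limits of images of points** (*"Fix a sequence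
`xⁱ ∈ 𝒳ⁱ_t` such that `φⁱ_t(xⁱ) → x^∞`"*).
[cite: Bamler2023, §5.4, Lemma 5.20 (arXiv v1 Lemma 121), proof] -/
theorem exists_seq_tendsto {t : ℝ} (ht : t ∈ S.I') {i : ℕ} (hi : t ∈ S.G i)
    {z : S.ℭ.Z ⟨t, ht.1⟩} (hz : z ∈ (S.m t ht).support) :
    ∃ x : ∀ k, (S.P (i + k)).flow.Slice ⟨t, (S.ℭ.dom_subset (i + k) (S.memDom hi k)).1⟩,
      Tendsto (fun k ↦ S.ℭ.φ (i + k) t (S.memDom hi k) (x k)) atTop (𝓝 z) := by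
  haveI := fun k ↦ (S.P (i + k)).isProbabilityMeasure_μ
    ⟨t, (S.ℭ.dom_subset (i + k) (S.memDom hi k)).1⟩
  exact exists_seq_tendsto_of_mem_support_of_tendsto_wassersteinW1_map (Z := S.ℭ.Z ⟨t, ht.1⟩)
    (fun k ↦ S.ℭ.φ (i + k) t (S.memDom hi k)) (fun k ↦ S.ℭ.isometry (i + k) t (S.memDom hi k))
    (fun k ↦ (S.P (i + k)).μ ⟨t, (S.ℭ.dom_subset (i + k) (S.memDom hi k)).1⟩)
    (S.tendsto_push_m ht hi) hz

/-- **`liminf μ^{i+k}_t(B(x_k, r)) > 0`** when `φ^{i+k}_t(x_k) → z ∈ supp μ^∞_t` (Bamler's first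
display in the proof of Claim 5.21).
[cite: Bamler2023, §5.4, Lemma 5.20, Claim 5.21 (arXiv v1 Claim 122), proof] -/
theorem liminf_measure_ball_pos {t : ℝ} (ht : t ∈ S.I') {i : ℕ} (hi : t ∈ S.G i)
    {z : S.ℭ.Z ⟨t, ht.1⟩} (hz : z ∈ (S.m t ht).support)
    {x : ∀ k, (S.P (i + k)).flow.Slice ⟨t, (S.ℭ.dom_subset (i + k) (S.memDom hi k)).1⟩}
    (hx : Tendsto (fun k ↦ S.ℭ.φ (i + k) t (S.memDom hi k) (x k)) atTop (𝓝 z)) {r : ℝ}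
    (hr : 0 < r) :
    0 < liminf (fun k ↦ (S.P (i + k)).μ ⟨t, (S.ℭ.dom_subset (i + k) (S.memDom hi k)).1⟩
      (Metric.ball (x k) r)) atTop := by
  haveI := fun k ↦ (S.P (i + k)).isProbabilityMeasure_μ
    ⟨t, (S.ℭ.dom_subset (i + k) (S.memDom hi k)).1⟩
  exact liminf_measure_ball_pos_of_tendsto_wassersteinW1_map (Z := S.ℭ.Z ⟨t, ht.1⟩)
    (fun k ↦ S.ℭ.φ (i + k) t (S.memDom hi k)) (fun k ↦ S.ℭ.isometry (i + k) t (S.memDom hi k))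
    (fun k ↦ (S.P (i + k)).μ ⟨t, (S.ℭ.dom_subset (i + k) (S.memDom hi k)).1⟩)
    (S.tendsto_push_m ht hi) hz hx hr

end ChainSetup

end MetricFlowPair

end Literature.Geometry.Riemannian

end
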